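import Summits.QuantumFields.YangMills.Theorems.LuscherReductionTwistedTraceScalingBTGaussianProfile
import Summits.QuantumFields.YangMills.Theorems.LuscherReductionTwistedTraceScalingKernelChartSandwich
import Summits.QuantumFields.YangMills.Theorems.LuscherReductionTwistedTraceScalingChartTransport
import Summits.QuantumFields.YangMills.Theorems.LuscherReductionTwistedTraceScalingGaussianTail
import HarnessLib

/-!
# (C1d-α) THE FLAT MODEL OF THE CENTRAL GAUSSIAN: the harmonic stiff kernel against its own ground state `e^{−q_{β/2,β}}`, in the chart coordinates,
# with the top eigenvalue `stiffGaussTop` and the Gaussian tail off a ball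
# (lane A of S-BASE, crux `TwistedTraceScaling` stmt-QuantumFields-20203, C4-CORE, the (OD) pen, brick (C1d) of `pub/ym-fleet/ym-luscher-20007-p1/COARSE-DESIGN.md` §27.8–§27.9)

The (OD) chain is reduced (`…BOCentralGlue.central_transfer_two_sided_of_bricks`) to a two-sided evaluation of the CENTRAL GAUSSIAN
`∫_V K_β(U', V)·G(V) dμ(V)` against product Haar, for a comparison function `G ≈ N̄·e^{−q(x(V))}` on the Gaussian bulk, `q = stiffGaussExp L (β/2) β`
(the frozen stiff exponent whose `e^{−q}` IS the ground state of the harmonic stiff kernel with `(t, b) = (β/2, β)`, `…BTGaussianProfile.stiff_groundState_stiffGaussExp`; the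
normalisation `(t,b) = (β/2, β)` is that of `…KernelChartSandwich.transferKernel_chart_sandwich`).  This file is the FLAT half of that evaluation — everything that lives on
`LinkSpace L` / the chart space `Edge → ℝ³` and involves no `SU(2)`:
* §1 `stiffGaussTop L t b = Πᵢ √(π/(aᵢ + b + √(aᵢ² + 2aᵢb)))` (`aᵢ` the eigenvalues of `t·H`) — the top eigenvalue of the harmonic stiff transfer kernel; `stiffGaussTop_pos`;
  `stiff_groundState_top` (the ground-state identity with this name for the constant);
* §2 the model integrand `m_{x'}(y) = e^{−⟪x',Ax'⟫}e^{−β‖x'−y‖²}e^{−⟪y,Ay⟫}e^{−q(y)}` (`A = (β/2)H`): non-negative, `≤ e^{−β‖y−x'‖²}`, continuous, integrable (`model_integrand_le_gauss`,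
  `integrable_model_integrand`);
* §3 ★ `model_integral_chart` — `∫_w m_{x'}(chartVec w) dw = stiffGaussTop·e^{−q(x')}` (volume-preserving chart transport `…ChartTransport.integral_comp_chartVec`);
* §4 ★★ `model_integral_off_le` / ★★ `model_integral_on_ge` — for a measurable `T ⊆ LinkSpace L` whose complement lies in `{R ≤ ‖y − x'‖}`:
  `∫ 𝟙_{Tᶜ} m_{x'} ≤ e^{−βR²/2}(2π/β)^{3|E|/2}` (`…GaussianTail.gaussian_tail_linkSpace_le` after a translation) and `∫ 𝟙_T m_{x'} ≥ stiffGaussTop·e^{−q(x')} − e^{−βR²/2}(2π/β)^{3|E|/2}`;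
  ★★ `model_integral_chart_core_ge` — the chart-ball instance `T = chartVec({w | ∀e, Σ_a w_e a² ≤ ρ²})` around a chart point `w'` with `Σ_a w'_e a² ≤ ρ'²`, `R = ρ − ρ'`.
The `SU(2)^E` half (chart decomposition, kernel sandwich, far tail, the two-sided evaluation) is the next file `…BOCentralGaussian`.
HONEST FRAMING: Gaussian calculus for a stub of a child of the CONDITIONAL route R2b1; (C1c), the `SU(2)` half of (C1d), (C4), (C5), (B-ST) OPEN; C4-CORE OPEN; not infinite volume,
not a gap, not Clay.
-/

set_option autoImplicit false

noncomputable section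

open MeasureTheory Filter Topology Real
open scoped BigOperators RealInnerProductSpace
open Literature.MathematicalPhysics.QuantumFieldTheory
open Literature.MathematicalPhysics.QuantumLattice

namespace Summit.QuantumFields.YangMills.Theorems.FemtoTransferGap.TwoLattice.ConstTube

open Summit.QuantumFields.YangMills.Theorems.FemtoTransferGap
open Summit.QuantumFields.YangMills.Theorems.FemtoTransferGap.TwoLattice
open Summit.QuantumFields.YangMills.Theorems.FemtoTransferGap.TwoLattice.Stiff
open Summit.QuantumFields.YangMills.Theorems.FemtoTransferGap.TwoLattice.GnChart

variable (L : ℕ) [NeZero L]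

/-! ## §1 The top eigenvalue of the harmonic stiff transfer kernel -/

/-- **The top eigenvalue of the harmonic stiff transfer kernel** `e^{−⟪x,tHx⟫}e^{−b‖x−y‖²}e^{−⟪y,tHy⟫}`: `Πᵢ √(π/(aᵢ + b + √(aᵢ² + 2aᵢb)))`, `aᵢ` the eigenvalues of `t·H`
(`H = d†d` the stiff Hessian of the `L³` torus); every zero mode contributes the free factor `√(π/b)`. [cite: Wipf2021, §8.5.2 (8.64)–(8.67)] -/
def stiffGaussTop (t b : ℝ) : ℝ :=
  ∏ i, Real.sqrt (π / ((isSymmetric_smul_stiffHessian (L := L) t).eigenvalues finrank_euclideanSpace i + b +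
    Real.sqrt ((isSymmetric_smul_stiffHessian (L := L) t).eigenvalues finrank_euclideanSpace i ^ 2 +
      2 * (isSymmetric_smul_stiffHessian (L := L) t).eigenvalues finrank_euclideanSpace i * b)))

variable {L}

/-- The eigenvalues of `t·H` are non-negative for `t ≥ 0`. [folklore] -/
theorem smul_stiffHessian_eigenvalues_nonneg {t : ℝ} (ht : 0 ≤ t) (i : Fin (Fintype.card (Edge 3 L × Fin 3))) :
    0 ≤ (isSymmetric_smul_stiffHessian (L := L) t).eigenvalues finrank_euclideanSpace i :=
  (isPositive_smul_stiffHessian L ht).nonneg_eigenvalues finrank_euclideanSpace i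

/-- `stiffGaussTop L t b > 0` for `t ≥ 0`, `b > 0`. [folklore] -/
theorem stiffGaussTop_pos {t : ℝ} (ht : 0 ≤ t) {b : ℝ} (hb : 0 < b) : 0 < stiffGaussTop L t b := by
  unfold stiffGaussTop
  refine Finset.prod_pos fun i _ => Real.sqrt_pos.2 (div_pos Real.pi_pos ?_)
  have ha := smul_stiffHessian_eigenvalues_nonneg (L := L) ht i
  positivity

/-- ★ The ground-state identity with the named constant: `∫ e^{−⟪x,tHx⟫}e^{−b‖x−y‖²}e^{−⟪y,tHy⟫}e^{−q_{t,b}(y)} dy = stiffGaussTop L t b · e^{−q_{t,b}(x)}`. [cite: Wipf2021, §8.5.2 (8.64)–(8.67)] -/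
theorem stiff_groundState_top {t : ℝ} (ht : 0 ≤ t) {b : ℝ} (hb : 0 < b) (x : LinkSpace L) :
    ∫ y, Real.exp (-⟪x, (t • stiffHessian L) x⟫) * Real.exp (-(b * ‖x - y‖ ^ 2)) * Real.exp (-⟪y, (t • stiffHessian L) y⟫) * Real.exp (-stiffGaussExp L t b y) =
      stiffGaussTop L t b * Real.exp (-stiffGaussExp L t b x) :=
  stiff_groundState_stiffGaussExp ht hb x

/-! ## §2 The model integrand -/

/-- `⟪y, tHy⟫ ≥ 0` for `t ≥ 0`. [folklore] -/
theorem inner_smul_stiffHessian_nonneg {t : ℝ} (ht : 0 ≤ t) (y : LinkSpace L) : 0 ≤ ⟪y, (t • stiffHessian L) y⟫ := by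
  rw [LinearMap.smul_apply, real_inner_smul_right, inner_stiffHessian]; positivity

/-- The model integrand is non-negative. [folklore] -/
theorem model_integrand_nonneg (t b : ℝ) (x y : LinkSpace L) :
    0 ≤ Real.exp (-⟪x, (t • stiffHessian L) x⟫) * Real.exp (-(b * ‖x - y‖ ^ 2)) * Real.exp (-⟪y, (t • stiffHessian L) y⟫) * Real.exp (-stiffGaussExp L t b y) := by
  positivity

/-- The model integrand is dominated by the centred Gaussian `e^{−b‖y − x‖²}` (`t ≥ 0`). [folklore] -/
theorem model_integrand_le_gauss {t : ℝ} (ht : 0 ≤ t) (b : ℝ) (x y : LinkSpace L) :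
    Real.exp (-⟪x, (t • stiffHessian L) x⟫) * Real.exp (-(b * ‖x - y‖ ^ 2)) * Real.exp (-⟪y, (t • stiffHessian L) y⟫) * Real.exp (-stiffGaussExp L t b y) ≤
      Real.exp (-b * ‖y - x‖ ^ 2) := by
  have h1 : Real.exp (-⟪x, (t • stiffHessian L) x⟫) ≤ 1 := Real.exp_le_one_iff.2 (neg_nonpos.2 (inner_smul_stiffHessian_nonneg ht x))
  have h3 : Real.exp (-⟪y, (t • stiffHessian L) y⟫) ≤ 1 := Real.exp_le_one_iff.2 (neg_nonpos.2 (inner_smul_stiffHessian_nonneg ht y))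
  have h4 : Real.exp (-stiffGaussExp L t b y) ≤ 1 := Real.exp_le_one_iff.2 (neg_nonpos.2 (stiffGaussExp_nonneg t b y))
  have h2 : Real.exp (-(b * ‖x - y‖ ^ 2)) = Real.exp (-b * ‖y - x‖ ^ 2) := by rw [norm_sub_rev]; ring_nf
  calc _ ≤ 1 * Real.exp (-(b * ‖x - y‖ ^ 2)) * 1 * 1 := by
        gcongr
    _ = Real.exp (-b * ‖y - x‖ ^ 2) := by rw [h2]; ring

/-- The model integrand is continuous in `y`. [folklore] -/
theorem continuous_model_integrand (t b : ℝ) (x : LinkSpace L) :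
    Continuous fun y : LinkSpace L => Real.exp (-⟪x, (t • stiffHessian L) x⟫) * Real.exp (-(b * ‖x - y‖ ^ 2)) * Real.exp (-⟪y, (t • stiffHessian L) y⟫) *
      Real.exp (-stiffGaussExp L t b y) := by
  have hH : Continuous fun y : LinkSpace L => (t • stiffHessian L) y := LinearMap.continuous_of_finiteDimensional _
  refine ((continuous_const.mul (Real.continuous_exp.comp ?_)).mul (Real.continuous_exp.comp ?_)).mul
    (Real.continuous_exp.comp (continuous_stiffGaussExp t b).neg)
  · exact (continuous_const.mul ((continuous_const.sub continuous_id).norm.pow 2)).neg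
  · exact (continuous_id.inner hH).neg

/-- The centred Gaussian `y ↦ e^{−b‖y − x‖²}` is integrable on `LinkSpace L` (`b > 0`). [folklore] -/
theorem integrable_gauss_shift {b : ℝ} (hb : 0 < b) (x : LinkSpace L) : Integrable (fun y : LinkSpace L => Real.exp (-b * ‖y - x‖ ^ 2)) := by
  have h := (integrable_rexp_neg_mul_sq_norm (V := LinkSpace L) hb).comp_sub_right x
  simpa only [Function.comp_def] using h

/-- ★ The model integrand is integrable (`t ≥ 0`, `b > 0`). [folklore] -/
theorem integrable_model_integrand {t : ℝ} (ht : 0 ≤ t) {b : ℝ} (hb : 0 < b) (x : LinkSpace L) :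
    Integrable fun y : LinkSpace L => Real.exp (-⟪x, (t • stiffHessian L) x⟫) * Real.exp (-(b * ‖x - y‖ ^ 2)) * Real.exp (-⟪y, (t • stiffHessian L) y⟫) *
      Real.exp (-stiffGaussExp L t b y) :=
  Integrable.mono' (integrable_gauss_shift hb x) (continuous_model_integrand t b x).aestronglyMeasurable
    (ae_of_all _ fun y => by
      rw [Real.norm_eq_abs, abs_of_nonneg (model_integrand_nonneg t b x y)]
      exact model_integrand_le_gauss ht b x y)

/-! ## §3 The model integral in the chart coordinates -/

/-- ★ **The model integral in the chart**: `∫_w m_{x'}(chartVec w) dw = stiffGaussTop L t b · e^{−q_{t,b}(x')}` (`t ≥ 0`, `b > 0`; the chart map `w ↦ chartVec w` is volume preserving).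
[cite: Wipf2021, §8.5.2 (8.64)–(8.67)] -/
theorem model_integral_chart {t : ℝ} (ht : 0 ≤ t) {b : ℝ} (hb : 0 < b) (x : LinkSpace L) :
    ∫ w : Edge 3 L → Fin 3 → ℝ, Real.exp (-⟪x, (t • stiffHessian L) x⟫) * Real.exp (-(b * ‖x - chartVec w‖ ^ 2)) *
        Real.exp (-⟪chartVec w, (t • stiffHessian L) (chartVec w)⟫) * Real.exp (-stiffGaussExp L t b (chartVec w)) =
      stiffGaussTop L t b * Real.exp (-stiffGaussExp L t b x) := by
  rw [integral_comp_chartVec L (fun y => Real.exp (-⟪x, (t • stiffHessian L) x⟫) * Real.exp (-(b * ‖x - y‖ ^ 2)) * Real.exp (-⟪y, (t • stiffHessian L) y⟫) *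
    Real.exp (-stiffGaussExp L t b y))]
  exact stiff_groundState_top ht hb x

/-- The chart version of integrability: `w ↦ m_{x'}(chartVec w)` is integrable. [folklore] -/
theorem integrable_model_integrand_chart {t : ℝ} (ht : 0 ≤ t) {b : ℝ} (hb : 0 < b) (x : LinkSpace L) :
    Integrable fun w : Edge 3 L → Fin 3 → ℝ => Real.exp (-⟪x, (t • stiffHessian L) x⟫) * Real.exp (-(b * ‖x - chartVec w‖ ^ 2)) *
        Real.exp (-⟪chartVec w, (t • stiffHessian L) (chartVec w)⟫) * Real.exp (-stiffGaussExp L t b (chartVec w)) := by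
  have h := ((volume_preserving_chartEquiv L).integrable_comp_emb (chartEquiv L).measurableEmbedding).2 (integrable_model_integrand ht hb x)
  simpa only [Function.comp_def, chartEquiv_apply] using h

/-! ## §4 The tail off a ball and the model integral on a core -/

/-- ★★ **Gaussian tail of the model**: if every point outside the measurable set `T` is at distance `≥ R ≥ 0` from `x'`, then `∫ 𝟙_{Tᶜ} m_{x'} ≤ e^{−bR²/2}·(π/(b/2))^{dim/2}`.
[folklore] -/
theorem model_integral_off_le {t : ℝ} (ht : 0 ≤ t) {b : ℝ} (hb : 0 < b) (x : LinkSpace L) {T : Set (LinkSpace L)} {R : ℝ} (hR : 0 ≤ R)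
    (hfar : ∀ y, y ∉ T → R ≤ ‖y - x‖) :
    ∫ y, Tᶜ.indicator (fun y => Real.exp (-⟪x, (t • stiffHessian L) x⟫) * Real.exp (-(b * ‖x - y‖ ^ 2)) * Real.exp (-⟪y, (t • stiffHessian L) y⟫) *
        Real.exp (-stiffGaussExp L t b y)) y ≤
      Real.exp (-(b * R ^ 2 / 2)) * (π / (b / 2)) ^ ((Module.finrank ℝ (LinkSpace L) : ℝ) / 2) := by
  -- pointwise: `𝟙_{Tᶜ} m ≤ 𝟙_{R ≤ ‖· − x‖} e^{−b‖· − x‖²}`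
  have hpt : ∀ y, Tᶜ.indicator (fun y => Real.exp (-⟪x, (t • stiffHessian L) x⟫) * Real.exp (-(b * ‖x - y‖ ^ 2)) * Real.exp (-⟪y, (t • stiffHessian L) y⟫) *
        Real.exp (-stiffGaussExp L t b y)) y ≤ {y : LinkSpace L | R ≤ ‖y‖}.indicator (fun y => Real.exp (-b * ‖y‖ ^ 2)) (y - x) := by
    intro y
    by_cases hy : y ∈ Tᶜ
    · have hmem : y - x ∈ {y : LinkSpace L | R ≤ ‖y‖} := hfar y hy
      rw [Set.indicator_of_mem hy, Set.indicator_of_mem hmem]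
      exact model_integrand_le_gauss ht b x y
    · rw [Set.indicator_of_notMem hy]
      exact Set.indicator_nonneg (fun _ _ => (Real.exp_pos _).le) _
  have h0 : ∀ y, 0 ≤ Tᶜ.indicator (fun y => Real.exp (-⟪x, (t • stiffHessian L) x⟫) * Real.exp (-(b * ‖x - y‖ ^ 2)) * Real.exp (-⟪y, (t • stiffHessian L) y⟫) *
        Real.exp (-stiffGaussExp L t b y)) y := fun y => Set.indicator_nonneg (fun _ _ => model_integrand_nonneg t b x _) _
  -- the shifted tail integrand is integrable
  have hmeas : MeasurableSet {y : LinkSpace L | R ≤ ‖y‖} := measurableSet_le measurable_const measurable_norm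
  have hint0 : Integrable (fun y : LinkSpace L => {y : LinkSpace L | R ≤ ‖y‖}.indicator (fun y => Real.exp (-b * ‖y‖ ^ 2)) y) :=
    (integrable_rexp_neg_mul_sq_norm (V := LinkSpace L) hb).indicator hmeas
  have hint : Integrable (fun y : LinkSpace L => {y : LinkSpace L | R ≤ ‖y‖}.indicator (fun y => Real.exp (-b * ‖y‖ ^ 2)) (y - x)) := by
    have h := hint0.comp_sub_right x
    simpa only [Function.comp_def] using h
  calc _ ≤ ∫ y, {y : LinkSpace L | R ≤ ‖y‖}.indicator (fun y => Real.exp (-b * ‖y‖ ^ 2)) (y - x) := integral_mono_of_nonneg (ae_of_all _ h0) hint (ae_of_all _ hpt)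
    _ = ∫ y, {y : LinkSpace L | R ≤ ‖y‖}.indicator (fun y => Real.exp (-b * ‖y‖ ^ 2)) y := integral_sub_right_eq_self _ x
    _ ≤ _ := gaussian_tail_linkSpace_le L hb hR

/-- ★★ **The model integral on a core**: under the same hypothesis, `∫ 𝟙_T m_{x'} ≥ stiffGaussTop·e^{−q(x')} − e^{−bR²/2}(π/(b/2))^{dim/2}`. [folklore] -/
theorem model_integral_on_ge {t : ℝ} (ht : 0 ≤ t) {b : ℝ} (hb : 0 < b) (x : LinkSpace L) {T : Set (LinkSpace L)} (hT : MeasurableSet T) {R : ℝ} (hR : 0 ≤ R)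
    (hfar : ∀ y, y ∉ T → R ≤ ‖y - x‖) :
    stiffGaussTop L t b * Real.exp (-stiffGaussExp L t b x) - Real.exp (-(b * R ^ 2 / 2)) * (π / (b / 2)) ^ ((Module.finrank ℝ (LinkSpace L) : ℝ) / 2) ≤
      ∫ y, T.indicator (fun y => Real.exp (-⟪x, (t • stiffHessian L) x⟫) * Real.exp (-(b * ‖x - y‖ ^ 2)) * Real.exp (-⟪y, (t • stiffHessian L) y⟫) *
        Real.exp (-stiffGaussExp L t b y)) y := by
  set m : LinkSpace L → ℝ := fun y => Real.exp (-⟪x, (t • stiffHessian L) x⟫) * Real.exp (-(b * ‖x - y‖ ^ 2)) * Real.exp (-⟪y, (t • stiffHessian L) y⟫) *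
    Real.exp (-stiffGaussExp L t b y) with hm
  have hint : Integrable m := integrable_model_integrand ht hb x
  have hsplit : ∫ y, m y = (∫ y, T.indicator m y) + ∫ y, Tᶜ.indicator m y := by
    rw [← integral_add (hint.indicator hT) (hint.indicator hT.compl)]
    refine integral_congr_ae (ae_of_all _ fun y => ?_)
    beta_reduce
    by_cases hy : y ∈ T
    · rw [Set.indicator_of_mem hy, Set.indicator_of_notMem (Set.notMem_compl_iff.2 hy)]; ring
    · rw [Set.indicator_of_notMem hy, Set.indicator_of_mem (Set.mem_compl hy)]; ring
  have hI : ∫ y, m y = stiffGaussTop L t b * Real.exp (-stiffGaussExp L t b x) := stiff_groundState_top ht hb x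
  have htail : ∫ y, Tᶜ.indicator m y ≤ Real.exp (-(b * R ^ 2 / 2)) * (π / (b / 2)) ^ ((Module.finrank ℝ (LinkSpace L) : ℝ) / 2) :=
    model_integral_off_le ht hb x hR hfar
  show _ ≤ ∫ y, T.indicator m y
  linarith

/-! ### The chart-ball instance -/

/-- On the chart, a link outside the `ρ`-ball is at chart distance `≥ ρ − ρ'` from any point of the `ρ'`-ball: if `Σ_a w'_e a² ≤ ρ'²` on every link and `Σ_a w_e a² > ρ²` on SOME
link, then `ρ − ρ' ≤ ‖chartVec w − chartVec w'‖` (`0 ≤ ρ' ≤ ρ`). [folklore] -/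
theorem norm_chartVec_sub_ge_of_exit {ρ ρ' : ℝ} (hρ' : 0 ≤ ρ') (hρ : ρ' ≤ ρ) {w w' : Edge 3 L → Fin 3 → ℝ} (hw' : ∀ e, ∑ a, w' e a ^ 2 ≤ ρ' ^ 2)
    {e : Edge 3 L} (he : ρ ^ 2 < ∑ a, w e a ^ 2) : ρ - ρ' ≤ ‖chartVec w - chartVec w'‖ := by
  -- `‖chartVec w − chartVec w'‖² ≥ Σ_a (w_e a − w'_e a)² ≥ (√Σ w² − √Σ w'²)² ≥ (ρ − ρ')²`
  have hρ0 : 0 ≤ ρ := hρ'.trans hρ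
  set p : EuclideanSpace ℝ (Fin 3) := WithLp.toLp 2 (w e) with hp
  set p' : EuclideanSpace ℝ (Fin 3) := WithLp.toLp 2 (w' e) with hp'
  have hnp : ‖p‖ ^ 2 = ∑ a, w e a ^ 2 := by
    rw [EuclideanSpace.norm_sq_eq]; simp [hp]
  have hnp' : ‖p'‖ ^ 2 = ∑ a, w' e a ^ 2 := by
    rw [EuclideanSpace.norm_sq_eq]; simp [hp']
  have hnd : ‖p - p'‖ ^ 2 = ∑ a, (w e a - w' e a) ^ 2 := by
    rw [EuclideanSpace.norm_sq_eq]; simp [hp, hp']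
  have h1 : ρ < ‖p‖ := by
    by_contra h
    have h' : ‖p‖ ≤ ρ := not_lt.mp h
    have := pow_le_pow_left₀ (norm_nonneg _) h' 2
    linarith [hnp]
  have h2 : ‖p'‖ ≤ ρ' := by
    by_contra h
    have h' : ρ' < ‖p'‖ := not_le.mp h
    have := pow_lt_pow_left₀ h' hρ' (n := 2) (by norm_num)
    linarith [hnp', hw' e]
  have h3 : ρ - ρ' ≤ ‖p - p'‖ := by
    have := norm_sub_norm_le p p'
    linarith
  have h4 : ‖p - p'‖ ^ 2 ≤ ‖chartVec w - chartVec w'‖ ^ 2 := by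
    rw [hnd, ← sum_sub_sq_eq_norm_chartVec_sub]
    exact Finset.single_le_sum (f := fun e => ∑ a, (w e a - w' e a) ^ 2) (fun e _ => Finset.sum_nonneg fun a _ => sq_nonneg _) (Finset.mem_univ e)
  have h5 : 0 ≤ ρ - ρ' := by linarith
  nlinarith [norm_nonneg (p - p'), norm_nonneg (chartVec w - chartVec w'), h3, h4]

/-- The chart ball `{w | ∀ e, Σ_a w_e a² ≤ ρ²}` is a closed, hence measurable, set. [folklore] -/
theorem measurableSet_chartBall (ρ : ℝ) : MeasurableSet {w : Edge 3 L → Fin 3 → ℝ | ∀ e, ∑ a, w e a ^ 2 ≤ ρ ^ 2} := by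
  have h : {w : Edge 3 L → Fin 3 → ℝ | ∀ e, ∑ a, w e a ^ 2 ≤ ρ ^ 2} = ⋂ e, {w | ∑ a, w e a ^ 2 ≤ ρ ^ 2} := by ext w; simp
  rw [h]
  refine MeasurableSet.iInter fun e => measurableSet_le ?_ measurable_const
  exact Finset.measurable_sum _ fun a _ => ((measurable_pi_apply a).comp (measurable_pi_apply e)).pow_const 2

/-- ★★ **The model integral on the chart core**: for `t ≥ 0`, `b > 0`, `0 ≤ ρ' ≤ ρ` and a chart point `w'` with `Σ_a w'_e a² ≤ ρ'²` on every link,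
`∫_w 𝟙{∀e, Σ_a w_e a² ≤ ρ²}·m_{chartVec w'}(chartVec w) dw ≥ stiffGaussTop·e^{−q(chartVec w')} − e^{−b(ρ−ρ')²/2}(π/(b/2))^{3|E|/2}`. [folklore] -/
theorem model_integral_chart_core_ge {t : ℝ} (ht : 0 ≤ t) {b : ℝ} (hb : 0 < b) {ρ ρ' : ℝ} (hρ' : 0 ≤ ρ') (hρ : ρ' ≤ ρ) {w' : Edge 3 L → Fin 3 → ℝ}
    (hw' : ∀ e, ∑ a, w' e a ^ 2 ≤ ρ' ^ 2) :
    stiffGaussTop L t b * Real.exp (-stiffGaussExp L t b (chartVec w')) -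
        Real.exp (-(b * (ρ - ρ') ^ 2 / 2)) * (π / (b / 2)) ^ ((Module.finrank ℝ (LinkSpace L) : ℝ) / 2) ≤
      ∫ w : Edge 3 L → Fin 3 → ℝ, {w : Edge 3 L → Fin 3 → ℝ | ∀ e, ∑ a, w e a ^ 2 ≤ ρ ^ 2}.indicator (fun w =>
        Real.exp (-⟪chartVec w', (t • stiffHessian L) (chartVec w')⟫) * Real.exp (-(b * ‖chartVec w' - chartVec w‖ ^ 2)) *
          Real.exp (-⟪chartVec w, (t • stiffHessian L) (chartVec w)⟫) * Real.exp (-stiffGaussExp L t b (chartVec w))) w := by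
  set x : LinkSpace L := chartVec w' with hx
  set T : Set (LinkSpace L) := {y | ∀ e, ∑ a, linkCurry y e a ^ 2 ≤ ρ ^ 2} with hT
  have hTm : MeasurableSet T := by
    have : T = (chartEquiv L).symm ⁻¹' {w : Edge 3 L → Fin 3 → ℝ | ∀ e, ∑ a, w e a ^ 2 ≤ ρ ^ 2} := by
      ext y; simp [hT, chartEquiv_symm_apply]
    rw [this]; exact (chartEquiv L).symm.measurable (measurableSet_chartBall ρ)
  have hfar : ∀ y, y ∉ T → ρ - ρ' ≤ ‖y - x‖ := by
    intro y hy
    simp only [hT, Set.mem_setOf_eq, not_forall, not_le] at hy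
    obtain ⟨e, he⟩ := hy
    have h := norm_chartVec_sub_ge_of_exit (L := L) hρ' hρ hw' (w := linkCurry y) he
    rwa [chartVec_linkCurry] at h
  have hmain := model_integral_on_ge ht hb x hTm (by linarith) hfar
  -- move the `LinkSpace` integral back to the chart
  have heq : ∫ y, T.indicator (fun y => Real.exp (-⟪x, (t • stiffHessian L) x⟫) * Real.exp (-(b * ‖x - y‖ ^ 2)) * Real.exp (-⟪y, (t • stiffHessian L) y⟫) *
        Real.exp (-stiffGaussExp L t b y)) y =
      ∫ w : Edge 3 L → Fin 3 → ℝ, {w : Edge 3 L → Fin 3 → ℝ | ∀ e, ∑ a, w e a ^ 2 ≤ ρ ^ 2}.indicator (fun w =>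
        Real.exp (-⟪chartVec w', (t • stiffHessian L) (chartVec w')⟫) * Real.exp (-(b * ‖chartVec w' - chartVec w‖ ^ 2)) *
          Real.exp (-⟪chartVec w, (t • stiffHessian L) (chartVec w)⟫) * Real.exp (-stiffGaussExp L t b (chartVec w))) w := by
    rw [← integral_comp_chartVec L]
    refine integral_congr_ae (ae_of_all _ fun w => ?_)
    beta_reduce
    have hmem : chartVec w ∈ T ↔ w ∈ {w : Edge 3 L → Fin 3 → ℝ | ∀ e, ∑ a, w e a ^ 2 ≤ ρ ^ 2} := by
      simp [hT, linkCurry_chartVec]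
    by_cases hw : w ∈ {w : Edge 3 L → Fin 3 → ℝ | ∀ e, ∑ a, w e a ^ 2 ≤ ρ ^ 2}
    · rw [Set.indicator_of_mem (hmem.2 hw), Set.indicator_of_mem hw]
    · rw [Set.indicator_of_notMem (fun h => hw (hmem.1 h)), Set.indicator_of_notMem hw]
  rw [← heq]; exact hmain

end Summit.QuantumFields.YangMills.Theorems.FemtoTransferGap.TwoLattice.ConstTube

end
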